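import Summits.ResolutionOfSingularities.ResolutionOfSingularities.Theorems.MarkedTransferCampaignW24ReducedRunCubic
import HarnessLib

/-!
# A verified 𝔽₂-bitmask evaluator for explicit one-variable computations in the reduced model: `F n = Σ_{i ∈ bits n} t^i`,
# carry-less products by kernel arithmetic, and the divided derivative `D^{(2^L−1)}` as a lattice mask
# (HIRONAKA-L, §9 kernel support for the OURS targets L-47B-s1, slots W2.4 / W2.4-β; reduced model of PREREG-K24 §B7; tool for
# the K-cell object «c136» booked by res-plan-2 2026-08-27T07:56:57Z (C); companion of `MarkedTransferCampaignW24ReducedRunCubic.lean`)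

**HONEST FRAMING.** OURS bookkeeping (see `MarkedTransferCampaignW24ReducedRun.lean`): plumbing that turns explicit polynomial
identities over `𝔽₂` (inside any field `K` of characteristic `2`) into kernel-decidable statements about natural numbers, so that
the TRANSIENT states of a universal reduced run (e.g. states `1…4` of `1/(1+t+t³)`, res-type-059's exploration carrier) can be
certified. Nothing below is a statement of [Hironaka2017], nothing asserts that any statement of it holds, nothing is a claim about
resolution of singularities; the manuscript stays «under review» (D-0012/D-0089). AI work, weaker than expert review.

## What is proved (`K` a field of characteristic `2`)
* `F n` (`coeff_F`: the `m`-th coefficient is the `m`-th binary digit of `n`), `F_zero`, `constantCoeff_F`, `coeff_F_eq_zero_of_lt`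
  (degree bound from `n < 2^B`), `F_xor : F (a ^^^ b) = F a + F b`, `F_two_pow_mul : F (2^k·a) = t^k·F a`,
  `cubicQ_eq_F : cubicQ N = F (1 ^^^ (2^N ^^^ 2^{3N}))`.
* `clmul fuel a b` (carry-less product, structural recursion on `fuel`), **`F_mul : F a · F b = F (clmul fuel a b)`** (`a < 2^fuel`).
* **`D_F_lattice`**: `D^{(2^L−1)}(t^{2^L−1}·F H) = F (H &&& μ)` for any mask `μ` whose digits below a bound `B > log₂ H` are the
  indicator of `2^L ∣ n` — the Lucas selection of `MarkedTransferCampaignW24ReducedRunCubic.D_kappa_sub`, in bitmask form.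
* **`univStep_FE3`**: the universal step on a state `t^{2^L−1}·F M·E3 U` (`M` odd, `2^L ∣ U`) is
  `t^{2^L−1}·F (clmul fuel M ((M ^^^ q_U) &&& μ))·E3 (2U)`, `q_U = 1 ^^^ 2^U ^^^ 2^{3U}` — every remaining check is arithmetic on numerals.
Hypotheses: each theorem's own binders. Written by res-D-pv-035 AS res-L1-k24. Standard axioms.
-/

noncomputable section

set_option linter.dupNamespace false -- mandated namespace of this single-conjunct summit

namespace Summit.ResolutionOfSingularities.ResolutionOfSingularities.Theorems

namespace CampaignW24

namespace ReducedRun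

open PowerSeries

universe u

section Bits

variable {K : Type u} [Field K] [CharP K 2]

/-- [OURS · L W2.4 reduced model] `F n = Σ_{i ∈ bits n} t^i`: the `𝔽₂`-polynomial with coefficient vector the binary digits of
`n`. [folklore] -/
def F (n : ℕ) : K⟦X⟧ := mk fun m => if n.testBit m then 1 else 0

omit [CharP K 2] in
/-- Coefficients of `F n`. [folklore] -/
theorem coeff_F (n m : ℕ) : coeff m (F n : K⟦X⟧) = if n.testBit m then 1 else 0 := coeff_mk _ _

omit [CharP K 2] in
/-- `F 0 = 0`. [folklore] -/
theorem F_zero : (F 0 : K⟦X⟧) = 0 := by ext m; rw [coeff_F, Nat.zero_testBit]; simp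

omit [CharP K 2] in
/-- The constant term of `F n` is the parity of `n`. [folklore] -/
theorem constantCoeff_F (n : ℕ) : constantCoeff (F n : K⟦X⟧) = if n % 2 = 1 then 1 else 0 := by
  rw [← coeff_zero_eq_constantCoeff_apply, coeff_F, Nat.testBit_zero]
  by_cases h : n % 2 = 1
  · rw [if_pos h, if_pos (decide_eq_true h)]
  · rw [if_neg h, if_neg (by simpa using h)]

omit [CharP K 2] in
/-- Degree bound: `n < 2^B` ⇒ the coefficients of `F n` vanish from `B` on. [folklore] -/
theorem coeff_F_eq_zero_of_lt {n B m : ℕ} (hn : n < 2 ^ B) (hm : B ≤ m) : coeff m (F n : K⟦X⟧) = 0 := by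
  rw [coeff_F, Nat.testBit_lt_two_pow (lt_of_lt_of_le hn (Nat.pow_le_pow_right two_pos hm))]; rfl

/-- In characteristic `2`: `F (a ^^^ b) = F a + F b`. [folklore] -/
theorem F_xor (a b : ℕ) : (F (a ^^^ b) : K⟦X⟧) = F a + F b := by
  ext m
  rw [map_add, coeff_F, coeff_F, coeff_F, Nat.testBit_xor]
  cases Nat.testBit a m <;> cases Nat.testBit b m <;> simp [CharTwo.add_self_eq_zero]

omit [CharP K 2] in
/-- `F (2^k · a) = t^k · F a`. [folklore] -/
theorem F_two_pow_mul (k a : ℕ) : (F (2 ^ k * a) : K⟦X⟧) = X ^ k * F a := by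
  ext m
  rw [coeff_F, coeff_X_pow_mul', Nat.testBit_two_pow_mul]
  by_cases h : k ≤ m
  · rw [if_pos h, coeff_F, decide_eq_true (show m ≥ k from h), Bool.true_and]
  · rw [if_neg h, decide_eq_false (show ¬ m ≥ k from h), Bool.false_and]; rfl

omit [CharP K 2] in
/-- `F (2^k) = t^k`. [folklore] -/
theorem F_two_pow (k : ℕ) : (F (2 ^ k) : K⟦X⟧) = X ^ k := by
  ext m
  rw [coeff_F, coeff_X_pow, Nat.testBit_two_pow]
  by_cases h : k = m
  · rw [decide_eq_true h, if_pos h.symm]; rfl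
  · rw [decide_eq_false h, if_neg (Ne.symm h)]; rfl

/-- `cubicQ N = F (1 ^^^ 2^N ^^^ 2^{3N})`. [folklore] -/
theorem cubicQ_eq_F (N : ℕ) : (cubicQ N : K⟦X⟧) = F (1 ^^^ (2 ^ N ^^^ 2 ^ (3 * N))) := by
  have h1 : (F 1 : K⟦X⟧) = 1 := by rw [show (1 : ℕ) = 2 ^ 0 from (pow_zero 2).symm, F_two_pow, pow_zero]
  unfold cubicQ
  rw [F_xor, F_xor, h1, F_two_pow, F_two_pow, add_assoc]

/-- [OURS · L W2.4 reduced model] carry-less (XOR) product of binary polynomials, by structural recursion on a fuel bound for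
the digits of the first factor. [folklore] -/
def clmul : ℕ → ℕ → ℕ → ℕ
  | 0, _, _ => 0
  | fuel + 1, a, b => (if a % 2 = 1 then b else 0) ^^^ (2 * clmul fuel (a / 2) b)

omit [CharP K 2] in
/-- Binary expansion step: `F a = [a odd] + t·F(a/2)`. [folklore] -/
theorem F_eq_add_X_mul (a : ℕ) : (F a : K⟦X⟧) = (if a % 2 = 1 then 1 else 0) + X * F (a / 2) := by
  ext m
  rw [map_add, coeff_F]
  rcases m with _ | m
  · rw [Nat.testBit_zero, coeff_zero_X_mul, add_zero]
    by_cases h : a % 2 = 1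
    · rw [if_pos h, decide_eq_true h, if_pos rfl, coeff_one, if_pos rfl]
    · rw [if_neg h, if_neg (by simpa using h), map_zero]
  · rw [Nat.testBit_add_one, coeff_succ_X_mul, coeff_F]
    by_cases h : a % 2 = 1
    · rw [if_pos h, coeff_one, if_neg (Nat.succ_ne_zero m), zero_add]
    · rw [if_neg h, map_zero, zero_add]

/-- **Carry-less product**: `F a · F b = F (clmul fuel a b)` whenever `a < 2^fuel`. [folklore] -/
theorem F_mul : ∀ (fuel a b : ℕ), a < 2 ^ fuel → (F a : K⟦X⟧) * F b = F (clmul fuel a b)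
  | 0, a, b, h => by
    have ha : a = 0 := by simpa using h
    subst ha; rw [F_zero, zero_mul, clmul, F_zero]
  | fuel + 1, a, b, h => by
    have ih := F_mul fuel (a / 2) b (by rw [pow_succ] at h; omega)
    show (F a : K⟦X⟧) * F b = F ((if a % 2 = 1 then b else 0) ^^^ (2 * clmul fuel (a / 2) b))
    rw [F_xor, ← pow_one 2, F_two_pow_mul, pow_one, ← ih, F_eq_add_X_mul a]
    by_cases ha : a % 2 = 1
    · rw [if_pos ha, if_pos ha]; ring
    · rw [if_neg ha, if_neg ha, F_zero]; ring

/-- **The divided derivative as a lattice mask**: `D^{(2^L−1)}(t^{2^L−1}·F H) = F (H &&& μ)` for every mask `μ` whose digits below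
a bound `B` (with `H < 2^B`) indicate `2^L ∣ n` (Lucas: `C(n + 2^L − 1, 2^L − 1) ≡ [2^L ∣ n] (mod 2)`). [folklore] -/
theorem D_F_lattice {L H μ B : ℕ} (hH : H < 2 ^ B) (hμ : ∀ n, n < B → μ.testBit n = decide (2 ^ L ∣ n)) :
    D (2 ^ L - 1) (X ^ (2 ^ L - 1) * (F H : K⟦X⟧)) = F (H &&& μ) := by
  have hP : 0 < 2 ^ L := pow_pos two_pos L
  ext n
  rw [coeff_D, coeff_X_pow_mul', if_pos (Nat.le_add_left _ _), Nat.add_sub_cancel, natCast_choose_two_pow_sub_one,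
    coeff_F, coeff_F, Nat.testBit_and]
  have hmod : (n + (2 ^ L - 1)) % 2 ^ L = 2 ^ L - 1 ↔ 2 ^ L ∣ n := by
    constructor
    · intro h
      have := Nat.dvd_sub_mod (n := 2 ^ L) (n + (2 ^ L - 1))
      rwa [h, Nat.add_sub_cancel] at this
    · rintro ⟨c, rfl⟩
      rw [add_comm, Nat.add_mul_mod_self_left, Nat.mod_eq_of_lt (Nat.sub_lt hP one_pos)]
  by_cases hn : n < B
  · rw [hμ n hn]
    by_cases hd : 2 ^ L ∣ n
    · rw [if_pos (hmod.mpr hd), one_mul, decide_eq_true hd, Bool.and_true]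
    · rw [if_neg (fun h => hd (hmod.mp h)), zero_mul, decide_eq_false hd, Bool.and_false]; rfl
  · have hHn : H.testBit n = false :=
      Nat.testBit_lt_two_pow (lt_of_lt_of_le hH (Nat.pow_le_pow_right two_pos (by omega)))
    rw [hHn, Bool.false_and]; simp

omit [CharP K 2] in
/-- Order of an `F`-state: `ord (t^K · F M · E3 U) = K` for `M` odd, `0 < U`. [folklore] -/
theorem order_FE3 {K' M U : ℕ} (hM : M % 2 = 1) (hU : 0 < U) :
    order (X ^ K' * ((F M : K⟦X⟧) * E3 U)) = (K' : ℕ) := by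
  rw [order_eq_nat]
  refine ⟨?_, fun m hm => by rw [coeff_X_pow_mul', if_neg (by omega)]⟩
  rw [coeff_X_pow_mul', if_pos le_rfl, Nat.sub_self, coeff_zero_eq_constantCoeff_apply, map_mul, constantCoeff_F,
    if_pos hM, constantCoeff_E3 hU, one_mul]
  exact one_ne_zero

/-- **The universal step on an explicit state** `t^{2^L−1}·F M·E3 U` (`M` odd, `2^L ∣ U`, `0 < U`): it is
`t^{2^L−1}·F (clmul fuel M ((M ^^^ q_U) &&& μ))·E3 (2U)` — the derivative factor is the lattice part of `M + cubicQ U` (Lucas),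
the product is carry-less, and `E3 U · E3 U = E3 (2U)`. All remaining checks are numeral arithmetic. [folklore] -/
theorem univStep_FE3 {L M U μ B fuel : ℕ} (hM : M % 2 = 1) (hU : 0 < U) (hLU : 2 ^ L ∣ U)
    (hB : M ^^^ (1 ^^^ (2 ^ U ^^^ 2 ^ (3 * U))) < 2 ^ B) (hμ : ∀ n, n < B → μ.testBit n = decide (2 ^ L ∣ n))
    (hfuel : M < 2 ^ fuel) :
    univStep (X ^ (2 ^ L - 1) * ((F M : K⟦X⟧) * E3 U)) =
      X ^ (2 ^ L - 1) * (F (clmul fuel M ((M ^^^ (1 ^^^ (2 ^ U ^^^ 2 ^ (3 * U)))) &&& μ)) * E3 (2 * U)) := by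
  have hP : 0 < 2 ^ L := pow_pos two_pos L
  have hKP : 2 ^ L - 1 < 2 ^ L := Nat.sub_lt hP one_pos
  set G : K⟦X⟧ := X ^ (2 ^ L - 1) * (F M * E3 U) with hG
  have hcoeff : coeff (2 ^ L - 1) G = 1 := by
    rw [hG, coeff_X_pow_mul', if_pos le_rfl, Nat.sub_self, coeff_zero_eq_constantCoeff_apply, map_mul, constantCoeff_F,
      if_pos hM, constantCoeff_E3 hU, one_mul]
  -- the derivative factor
  obtain ⟨L', rfl⟩ : ∃ L', U = 2 ^ L * L' := hLU
  have hsupp : Literature.RingTheory.MvPowerSeries.IsSupportedOnMultiples (2 ^ L)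
      ((cubicQ (2 ^ L * L') : K⟦X⟧) : MvPowerSeries Unit K) :=
    (isSupportedOnMultiples_cubicQ (2 ^ L * L')).of_dvd (dvd_mul_right _ _)
  have hlin := D_mul_of_isSupportedOnMultiples 2 (L := L) hKP hsupp (G - X ^ (2 ^ L - 1))
  have hprod : cubicQ (2 ^ L * L') * (G - X ^ (2 ^ L - 1)) =
      X ^ (2 ^ L - 1) * (F (M ^^^ (1 ^^^ (2 ^ (2 ^ L * L') ^^^ 2 ^ (3 * (2 ^ L * L'))))) : K⟦X⟧) := by
    rw [F_xor, ← cubicQ_eq_F, hG]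
    calc cubicQ (2 ^ L * L') * (X ^ (2 ^ L - 1) * (F M * E3 (2 ^ L * L')) - X ^ (2 ^ L - 1))
        = X ^ (2 ^ L - 1) * F M * (cubicQ (2 ^ L * L') * E3 (2 ^ L * L')) - X ^ (2 ^ L - 1) * cubicQ (2 ^ L * L') := by
          ring
      _ = X ^ (2 ^ L - 1) * (F M + cubicQ (2 ^ L * L')) := by
          rw [cubicQ_mul_E3 hU, mul_one, sub_eq_add_neg, neg_eq_self_charTwo]; ring
  have hD : D (2 ^ L - 1) (G - X ^ (2 ^ L - 1)) =
      F ((M ^^^ (1 ^^^ (2 ^ (2 ^ L * L') ^^^ 2 ^ (3 * (2 ^ L * L'))))) &&& μ) * E3 (2 ^ L * L') := by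
    calc D (2 ^ L - 1) (G - X ^ (2 ^ L - 1))
        = E3 (2 ^ L * L') * (cubicQ (2 ^ L * L') * D (2 ^ L - 1) (G - X ^ (2 ^ L - 1))) := by
          rw [← mul_assoc, mul_comm (E3 _), cubicQ_mul_E3 hU, one_mul]
      _ = _ := by rw [← hlin, hprod, D_F_lattice hB hμ, mul_comm]
  -- the step
  unfold univStep
  rw [order_FE3 hM hU, ENat.toNat_coe, hcoeff, inv_one]
  unfold univStepI
  rw [hcoeff, map_one, one_mul, one_mul, hD, neg_eq_self_charTwo, hG]
  calc X ^ (2 ^ L - 1) * (F M * E3 (2 ^ L * L')) *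
        (F ((M ^^^ (1 ^^^ (2 ^ (2 ^ L * L') ^^^ 2 ^ (3 * (2 ^ L * L'))))) &&& μ) * E3 (2 ^ L * L'))
      = X ^ (2 ^ L - 1) * ((F M * F ((M ^^^ (1 ^^^ (2 ^ (2 ^ L * L') ^^^ 2 ^ (3 * (2 ^ L * L'))))) &&& μ)) *
          (E3 (2 ^ L * L') * E3 (2 ^ L * L'))) := by ring
    _ = _ := by rw [F_mul fuel _ _ hfuel, E3_mul_E3 hU]

end Bits

end ReducedRun

end CampaignW24

end Summit.ResolutionOfSingularities.ResolutionOfSingularities.Theorems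

end
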